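import Mathlib
import HarnessLib

/-!
# Extreme points of the feasible polytope are the basic feasible solutions (Luenberger–Ye, §2.5)

[LY08] = D. G. Luenberger, Y. Ye, *Linear and Nonlinear Programming* [LuenbergerYe2008], chapter
"Basic Properties of Linear Programs" (Ch. 2 in the held copy
`book:luenberger2008-linear-nonlinear-programming` and in the Springer 2008 printing), §2.5
"Relations to convexity": for `K = {x : Ax = b, x ≥ 0}` (17), the **Theorem (Equivalence of extreme
points and basic solutions)** — `x` is an extreme point of `K` iff `x` is a basic feasible solution,
i.e. iff `x ∈ K` and the columns `a_j` with `x_j > 0` are linearly independent — and **Corollary 3**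
(`K` has at most finitely many extreme points: an extreme point is determined by its set of basic
columns).

Linear independence of the support columns is recorded in the kernel form used by the book's proof
("there is a nontrivial linear combination that is zero: y₁a₁ + ⋯ + y_ka_k = 0"):
`SupportColsIndependent A x := ∀ w, (x_j = 0 ⇒ w_j = 0) → Aw = 0 → w = 0`.

Results recorded:
* `feasibleSet`, `SupportColsIndependent`;
* `eq_of_convex_combination` — the first half of the proof: if `x = αy + (1 − α)z` with
  `y, z ∈ K`, `0 < α < 1` and the support columns of `x` are independent, then `y = x = z`;
* `exists_ne_mem_openSegment` — the second half: if the support columns are dependent, `x` is the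
  midpoint of two distinct points `x ± εy` of `K`;
* `mem_extremePoints_iff` — the **Equivalence Theorem**;
* `eq_of_support_subset` and `extremePoints_finite` — **Corollary 3**;
* `exists_dependence_with_pos_entry`, `exists_smaller_support_along`,
  `exists_feasible_smaller_support`, `cost_dotProduct_eq_zero_of_optimal` ((16): `cᵀy = 0` at an
  optimum), `exists_optimal_smaller_support`, `exists_basic_feasible`,
  `exists_optimal_basic_feasible` — the Case-2 reduction and parts (i)/(ii) of the **Fundamental
  theorem of linear programming** (§2.4) in support form;
* `extremePoints_nonempty`, `exists_optimal_mem_extremePoints` — **Corollaries 1 and 2**.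

Companion in-tree file: `BasicOptimumSolution.lean` treats Schrijver's inequality form `Ax ≤ b`
via tight rows (vertices of pointed polyhedra) and does not mention `Set.extremePoints`; the present
file is the standard-form statement in Mathlib's convexity language (`Set.extremePoints ℝ`,
`openSegment ℝ`).

Published results only (Lean placement rule): every public declaration carries its
`[cite: LuenbergerYe2008, §2.4 / §2.5 …]` locator.
-/

namespace Literature.Analysis.Convex.ExtremePointsBasicSolutions

open Matrix Finset

variable {m n : Type*} [Fintype n]

/-- The constraint set (17): `K = {x : Ax = b, x ≥ 0}`. [cite: LuenbergerYe2008, §2.5 (17)] -/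
def feasibleSet (A : Matrix m n ℝ) (b : m → ℝ) : Set (n → ℝ) := {x | A *ᵥ x = b ∧ 0 ≤ x}

/-- The columns `a_j` carrying the nonzero components of `x` are linearly independent: no nontrivial
combination `y₁a₁ + ⋯ + y_ka_k = 0` supported on `{j : x_j ≠ 0}` ("basic" for a feasible `x`,
possibly degenerate). [cite: LuenbergerYe2008, §2.5 Theorem (Equivalence of extreme points and
basic solutions), proof ("Suppose a₁, …, a_k are linearly dependent …")] -/
def SupportColsIndependent (A : Matrix m n ℝ) (x : n → ℝ) : Prop :=
  ∀ w : n → ℝ, (∀ j, x j = 0 → w j = 0) → A *ᵥ w = 0 → w = 0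

/-- First half of the proof: a point of `K` whose support columns are independent is not a proper
convex combination of two other points of `K` — from `x = αy + βz`, `α, β > 0`, `α + β = 1`, the
components of `y`, `z` off the support of `x` vanish, and `A(y − z) = 0` forces `y = z = x`.
[cite: LuenbergerYe2008, §2.5 Equivalence Theorem, proof (first part)] -/
theorem eq_of_convex_combination (A : Matrix m n ℝ) (b : m → ℝ) {x y z : n → ℝ}
    (hx : SupportColsIndependent A x) (hy : y ∈ feasibleSet A b) (hz : z ∈ feasibleSet A b)
    {α β : ℝ} (hα : 0 < α) (hβ : 0 < β) (hαβ : α + β = 1) (hxyz : α • y + β • z = x) :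
    y = x ∧ z = x := by
  obtain ⟨hAy, hy0⟩ := hy
  obtain ⟨hAz, hz0⟩ := hz
  -- off the support of `x` both `y` and `z` vanish
  have hoff : ∀ j, x j = 0 → y j = 0 ∧ z j = 0 := by
    intro j hj
    have h := congrFun hxyz j
    simp only [Pi.add_apply, Pi.smul_apply, smul_eq_mul, hj] at h
    have h1 : 0 ≤ y j := hy0 j
    have h2 : 0 ≤ z j := hz0 j
    constructor <;> nlinarith
  -- `y − z` is supported on the support of `x` and lies in the kernel of `A`
  have hyz : y - z = 0 := hx (y - z)
    (fun j hj => by rw [Pi.sub_apply, (hoff j hj).1, (hoff j hj).2, sub_zero])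
    (by rw [mulVec_sub, hAy, hAz, sub_self])
  obtain rfl : y = z := sub_eq_zero.1 hyz
  have hyx : y = x := by
    calc y = (α + β) • y := by rw [hαβ, one_smul]
      _ = x := by rw [add_smul, hxyz]
  exact ⟨hyx, hyx⟩

/-- Second half of the proof: if the support columns of a point `x ∈ K` are dependent —
`Ay = 0` for some `y ≠ 0` vanishing off the support — then for a suitable `ε > 0` both `x + εy`
and `x − εy` lie in `K`, they are distinct, and `x = ½(x + εy) + ½(x − εy)`.
[cite: LuenbergerYe2008, §2.5 Equivalence Theorem, proof (converse part)] -/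
theorem exists_ne_mem_openSegment (A : Matrix m n ℝ) (b : m → ℝ) {x : n → ℝ}
    (hxK : x ∈ feasibleSet A b) {y : n → ℝ} (hy0 : y ≠ 0) (hsupp : ∀ j, x j = 0 → y j = 0)
    (hAy : A *ᵥ y = 0) :
    ∃ ε : ℝ, 0 < ε ∧ x + ε • y ∈ feasibleSet A b ∧ x - ε • y ∈ feasibleSet A b ∧
      x + ε • y ≠ x - ε • y ∧ x ∈ openSegment ℝ (x + ε • y) (x - ε • y) := by
  classical
  obtain ⟨hAx, hx0⟩ := hxK
  -- the indices where `y` is nonzero; there `x_j > 0`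
  set T : Finset n := univ.filter fun j => y j ≠ 0 with hT
  have hTne : T.Nonempty := by
    by_contra h
    rw [Finset.not_nonempty_iff_eq_empty] at h
    apply hy0
    ext j
    by_contra hj
    have : j ∈ T := by rw [hT, mem_filter]; exact ⟨mem_univ j, hj⟩
    rw [h] at this
    exact absurd this (Finset.notMem_empty j)
  have hpos : ∀ j ∈ T, 0 < x j / |y j| := by
    intro j hj
    have hyj : y j ≠ 0 := (mem_filter.1 hj).2
    have hxj : x j ≠ 0 := fun h => hyj (hsupp j h)
    exact div_pos (lt_of_le_of_ne (hx0 j) (Ne.symm hxj)) (abs_pos.2 hyj)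
  set ε := T.inf' hTne fun j => x j / |y j| with hε
  have hεpos : 0 < ε := by
    rw [hε, Finset.lt_inf'_iff]
    exact hpos
  have hεle : ∀ j, ε * |y j| ≤ x j := by
    intro j
    by_cases hyj : y j = 0
    · rw [hyj, abs_zero, mul_zero]; exact hx0 j
    · have hj : j ∈ T := by rw [hT, mem_filter]; exact ⟨mem_univ j, hyj⟩
      have h1 : ε ≤ x j / |y j| := Finset.inf'_le _ hj
      rwa [le_div_iff₀ (abs_pos.2 hyj)] at h1
  have hplus : x + ε • y ∈ feasibleSet A b := by
    refine ⟨by rw [mulVec_add, mulVec_smul, hAx, hAy, smul_zero, add_zero], fun j => ?_⟩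
    simp only [Pi.add_apply, Pi.smul_apply, smul_eq_mul, Pi.zero_apply]
    have := hεle j
    have h2 : -(ε * |y j|) ≤ ε * y j := by
      rw [← mul_neg]; exact mul_le_mul_of_nonneg_left (neg_abs_le _) hεpos.le
    linarith
  have hminus : x - ε • y ∈ feasibleSet A b := by
    refine ⟨by rw [mulVec_sub, mulVec_smul, hAx, hAy, smul_zero, sub_zero], fun j => ?_⟩
    simp only [Pi.sub_apply, Pi.smul_apply, smul_eq_mul, Pi.zero_apply]
    have := hεle j
    have h2 : ε * y j ≤ ε * |y j| := mul_le_mul_of_nonneg_left (le_abs_self _) hεpos.le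
    linarith
  have hne : x + ε • y ≠ x - ε • y := by
    intro h
    have h2 : (2 * ε) • y = 0 := by
      rw [mul_smul, two_smul]
      have := sub_eq_zero.2 h
      rw [add_sub_sub_cancel] at this
      exact this
    rcases smul_eq_zero.1 h2 with h3 | h3
    · exact absurd h3 (by positivity)
    · exact hy0 h3
  refine ⟨ε, hεpos, hplus, hminus, hne, ?_⟩
  refine ⟨1 / 2, 1 / 2, by norm_num, by norm_num, by norm_num, ?_⟩
  rw [smul_add, smul_sub, add_add_sub_cancel, ← add_smul]
  norm_num

/-- **Theorem (Equivalence of extreme points and basic solutions).** A vector `x` is an extreme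
point of `K = {x : Ax = b, x ≥ 0}` iff `x ∈ K` and the columns of `A` carrying its nonzero
components are linearly independent (a basic feasible solution, degenerate if fewer than `m`
components are positive). [cite: LuenbergerYe2008, §2.5 Theorem (Equivalence of extreme points
and basic solutions)] -/
theorem mem_extremePoints_iff (A : Matrix m n ℝ) (b : m → ℝ) (x : n → ℝ) :
    x ∈ (feasibleSet A b).extremePoints ℝ ↔ x ∈ feasibleSet A b ∧ SupportColsIndependent A x := by
  rw [mem_extremePoints]
  constructor
  · rintro ⟨hxK, hext⟩
    refine ⟨hxK, fun w hsupp hAw => ?_⟩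
    by_contra hw
    obtain ⟨ε, -, hplus, hminus, hne, hseg⟩ := exists_ne_mem_openSegment A b hxK hw hsupp hAw
    obtain ⟨h1, h2⟩ := hext _ hplus _ hminus hseg
    exact hne (h1.trans h2.symm)
  · rintro ⟨hxK, hind⟩
    refine ⟨hxK, fun y hy z hz hseg => ?_⟩
    obtain ⟨α, β, hα, hβ, hαβ, hxyz⟩ := hseg
    exact eq_of_convex_combination A b hind hy hz hα hβ hαβ hxyz

/-- An extreme point is determined by its support: two points of `K` with independent support
columns and nested supports coincide (both solve the nonsingular system in the basic columns).
[cite: LuenbergerYe2008, §2.5 Corollary 3, proof ("the extreme points of K are a subset of these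
basic solutions")] -/
theorem eq_of_support_subset (A : Matrix m n ℝ) (b : m → ℝ) {x x' : n → ℝ}
    (hx : x ∈ feasibleSet A b) (hx' : x' ∈ feasibleSet A b) (hind : SupportColsIndependent A x)
    (hsub : ∀ j, x j = 0 → x' j = 0) : x' = x := by
  have h := hind (x' - x) (fun j hj => by rw [Pi.sub_apply, hsub j hj, hj, sub_zero])
    (by rw [mulVec_sub, hx.1, hx'.1, sub_self])
  exact sub_eq_zero.1 h

/-- **Corollary 3.** The constraint set `K` possesses at most a finite number of extreme points
(each is determined by the finite set of its basic columns). [cite: LuenbergerYe2008, §2.5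
Corollary 3] -/
theorem extremePoints_finite (A : Matrix m n ℝ) (b : m → ℝ) :
    ((feasibleSet A b).extremePoints ℝ).Finite := by
  classical
  refine Set.Finite.of_finite_image (f := fun x : n → ℝ => univ.filter fun j => x j ≠ 0)
    (Set.toFinite _) ?_
  intro x hx x' hx' hxx'
  rw [mem_extremePoints_iff] at hx hx'
  refine (eq_of_support_subset A b hx.1 hx'.1 hx.2 fun j hj => ?_).symm
  by_contra hj'
  have h1 : j ∈ univ.filter fun k => x' k ≠ 0 := mem_filter.2 ⟨mem_univ j, hj'⟩
  have h2 : j ∉ univ.filter fun k => x k ≠ 0 := fun h => (mem_filter.1 h).2 hj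
  simp only at hxx'
  rw [hxx'] at h2
  exact h2 h1

/-- The sign-fixing step of Case 2 of §2.4: a nontrivial dependence among the support columns may
be taken with at least one positive coefficient (replace `y` by `−y` otherwise).
[cite: LuenbergerYe2008, §2.4 Fundamental theorem, proof of (i), Case 2 ("at least one y_i is
positive")] -/
theorem exists_dependence_with_pos_entry (A : Matrix m n ℝ) {x : n → ℝ}
    (hdep : ¬ SupportColsIndependent A x) :
    ∃ y : n → ℝ, (∀ j, x j = 0 → y j = 0) ∧ A *ᵥ y = 0 ∧ (∃ j, 0 < y j) ∧
      ∃ w : n → ℝ, w ≠ 0 ∧ (∀ j, x j = 0 → w j = 0) ∧ A *ᵥ w = 0 ∧ (y = w ∨ y = -w) := by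
  unfold SupportColsIndependent at hdep
  push Not at hdep
  obtain ⟨w, hsupp, hAw, hw0⟩ := hdep
  by_cases hpos : ∃ j, 0 < w j
  · exact ⟨w, hsupp, hAw, hpos, w, hw0, hsupp, hAw, Or.inl rfl⟩
  · push Not at hpos
    have hne : ∃ j, w j ≠ 0 := by
      by_contra h
      push Not at h
      exact hw0 (funext h)
    obtain ⟨j, hj⟩ := hne
    refine ⟨-w, fun k hk => by rw [Pi.neg_apply, hsupp k hk, neg_zero],
      by rw [mulVec_neg, hAw, neg_zero], ⟨j, ?_⟩, w, hw0, hsupp, hAw, Or.inr rfl⟩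
    rw [Pi.neg_apply, neg_pos]
    exact lt_of_le_of_ne (hpos j) hj

/-- The reduction step of the Fundamental Theorem (Case 2 of §2.4): for a feasible `x` and a kernel
direction `y` vanishing off the support of `x` with some `y_j > 0`, the choice
`ε = min {x_j/y_j : y_j > 0}` makes `x − εy` feasible (15), keeps every zero component of `x`, and
annihilates at least one more component.
[cite: LuenbergerYe2008, §2.4 Fundamental theorem of linear programming, proof of (i), Case 2,
(15) and ε = min{x_i/y_i : y_i > 0}] -/
theorem exists_smaller_support_along (A : Matrix m n ℝ) (b : m → ℝ) {x : n → ℝ}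
    (hxK : x ∈ feasibleSet A b) {y : n → ℝ} (hysupp : ∀ j, x j = 0 → y j = 0) (hAy : A *ᵥ y = 0)
    (hpos : ∃ j, 0 < y j) :
    ∃ ε : ℝ, 0 ≤ ε ∧ x - ε • y ∈ feasibleSet A b ∧ (∀ j, x j = 0 → (x - ε • y) j = 0) ∧
      ∃ j, x j ≠ 0 ∧ (x - ε • y) j = 0 := by
  classical
  obtain ⟨hAx, hx0⟩ := hxK
  obtain ⟨j₀, hj₀⟩ := hpos
  set T : Finset n := univ.filter fun j => 0 < y j with hT
  have hj₀T : j₀ ∈ T := mem_filter.2 ⟨mem_univ _, hj₀⟩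
  have hTne : T.Nonempty := ⟨j₀, hj₀T⟩
  set ε := T.inf' hTne fun j => x j / y j with hε
  have hεle : ∀ j ∈ T, ε * y j ≤ x j := fun j hj => by
    have h1 : ε ≤ x j / y j := Finset.inf'_le _ hj
    rwa [le_div_iff₀ (mem_filter.1 hj).2] at h1
  have hεnn : 0 ≤ ε := by
    rw [hε, Finset.le_inf'_iff]
    intro j hj
    exact div_nonneg (hx0 j) (mem_filter.1 hj).2.le
  obtain ⟨j₁, hj₁T, hj₁⟩ := Finset.exists_mem_eq_inf' hTne fun j => x j / y j
  refine ⟨ε, hεnn, ⟨by rw [mulVec_sub, mulVec_smul, hAx, hAy, smul_zero, sub_zero], fun j => ?_⟩,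
    fun j hj => ?_, j₁, ?_, ?_⟩
  · simp only [Pi.sub_apply, Pi.smul_apply, smul_eq_mul, Pi.zero_apply, sub_nonneg]
    by_cases hyj : 0 < y j
    · exact hεle j (mem_filter.2 ⟨mem_univ j, hyj⟩)
    · exact le_trans (mul_nonpos_of_nonneg_of_nonpos hεnn (not_lt.1 hyj)) (hx0 j)
  · rw [Pi.sub_apply, Pi.smul_apply, smul_eq_mul, hj, hysupp j hj, mul_zero, sub_zero]
  · intro h
    have := hysupp j₁ h
    have h2 := (mem_filter.1 hj₁T).2
    rw [this] at h2
    exact lt_irrefl _ h2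
  · have hy1 : y j₁ ≠ 0 := (mem_filter.1 hj₁T).2.ne'
    rw [Pi.sub_apply, Pi.smul_apply, smul_eq_mul, hε, hj₁, div_mul_cancel₀ _ hy1, sub_self]

/-- Case 2 for part (i): a feasible `x` with dependent support columns can be replaced by a
feasible point with strictly smaller support. [cite: LuenbergerYe2008, §2.4 Fundamental theorem,
proof of (i), Case 2] -/
theorem exists_feasible_smaller_support (A : Matrix m n ℝ) (b : m → ℝ) {x : n → ℝ}
    (hxK : x ∈ feasibleSet A b) (hdep : ¬ SupportColsIndependent A x) :
    ∃ x' ∈ feasibleSet A b, (∀ j, x j = 0 → x' j = 0) ∧ ∃ j, x j ≠ 0 ∧ x' j = 0 := by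
  obtain ⟨y, hysupp, hAy, hpos, -⟩ := exists_dependence_with_pos_entry A hdep
  obtain ⟨ε, -, hK, hsub, hnew⟩ := exists_smaller_support_along A b hxK hysupp hAy hpos
  exact ⟨_, hK, hsub, hnew⟩

/-- The key observation of the proof of (ii), (16): at an OPTIMAL feasible `x`, a kernel direction
`y ≠ 0` vanishing off the support has `cᵀy = 0`, since `x − εy` is feasible for `ε` of either
sign and small magnitude. [cite: LuenbergerYe2008, §2.4 Fundamental theorem, proof of (ii), (16)
("Thus we conclude that cᵀy = 0")] -/
theorem cost_dotProduct_eq_zero_of_optimal (A : Matrix m n ℝ) (b : m → ℝ) (c : n → ℝ)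
    {x : n → ℝ} (hxK : x ∈ feasibleSet A b) (hopt : ∀ z ∈ feasibleSet A b, c ⬝ᵥ x ≤ c ⬝ᵥ z)
    {y : n → ℝ} (hy0 : y ≠ 0) (hsupp : ∀ j, x j = 0 → y j = 0) (hAy : A *ᵥ y = 0) :
    c ⬝ᵥ y = 0 := by
  obtain ⟨ε, hε, hplus, hminus, -, -⟩ := exists_ne_mem_openSegment A b hxK hy0 hsupp hAy
  have h1 := hopt _ hplus
  have h2 := hopt _ hminus
  rw [dotProduct_add, dotProduct_smul, smul_eq_mul] at h1
  rw [dotProduct_sub, dotProduct_smul, smul_eq_mul] at h2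
  have h3 : ε * (c ⬝ᵥ y) = 0 := le_antisymm (by linarith) (by linarith)
  exact (mul_eq_zero.1 h3).resolve_left hε.ne'

/-- Case 2 for part (ii): an optimal feasible `x` with dependent support columns can be replaced by
a feasible point with the same cost (hence still optimal) and strictly smaller support.
[cite: LuenbergerYe2008, §2.4 Fundamental theorem, proof of (ii), Case 2] -/
theorem exists_optimal_smaller_support (A : Matrix m n ℝ) (b : m → ℝ) (c : n → ℝ) {x : n → ℝ}
    (hxK : x ∈ feasibleSet A b) (hopt : ∀ z ∈ feasibleSet A b, c ⬝ᵥ x ≤ c ⬝ᵥ z)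
    (hdep : ¬ SupportColsIndependent A x) :
    ∃ x' ∈ feasibleSet A b, c ⬝ᵥ x' = c ⬝ᵥ x ∧ (∀ j, x j = 0 → x' j = 0) ∧
      ∃ j, x j ≠ 0 ∧ x' j = 0 := by
  obtain ⟨y, hysupp, hAy, hpos, w, hw0, hwsupp, hAw, hyw⟩ := exists_dependence_with_pos_entry A hdep
  have hcw : c ⬝ᵥ w = 0 := cost_dotProduct_eq_zero_of_optimal A b c hxK hopt hw0 hwsupp hAw
  have hcy : c ⬝ᵥ y = 0 := by
    rcases hyw with rfl | rfl
    · exact hcw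
    · rw [dotProduct_neg, hcw, neg_zero]
  obtain ⟨ε, -, hK, hsub, hnew⟩ := exists_smaller_support_along A b hxK hysupp hAy hpos
  refine ⟨_, hK, ?_, hsub, hnew⟩
  rw [dotProduct_sub, dotProduct_smul, smul_eq_mul, hcy, mul_zero, sub_zero]

/-- **Fundamental theorem of linear programming, part (i)** (support form): if
`Ax = b, x ≥ 0` has a feasible solution, it has a basic feasible solution — one whose support
columns are linearly independent — with support inside that of the given solution (induction on
the number of positive variables). [cite: LuenbergerYe2008, §2.4 Fundamental theorem of linear
programming (i)] -/
theorem exists_basic_feasible (A : Matrix m n ℝ) (b : m → ℝ) :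
    ∀ (N : ℕ) (x : n → ℝ), x ∈ feasibleSet A b →
      (univ.filter fun j => x j ≠ 0).card ≤ N →
      ∃ x' ∈ feasibleSet A b, SupportColsIndependent A x' ∧ ∀ j, x j = 0 → x' j = 0 := by
  classical
  intro N
  induction N with
  | zero =>
    intro x hx hcard
    refine ⟨x, hx, fun w hw _ => ?_, fun _ h => h⟩
    have hall : ∀ j, x j = 0 := fun j => by
      by_contra hj
      have : j ∈ univ.filter fun k => x k ≠ 0 := mem_filter.2 ⟨mem_univ j, hj⟩
      rw [Finset.card_eq_zero.1 (Nat.le_zero.1 hcard)] at this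
      exact absurd this (Finset.notMem_empty j)
    exact funext fun j => hw j (hall j)
  | succ N ih =>
    intro x hx hcard
    by_cases hind : SupportColsIndependent A x
    · exact ⟨x, hx, hind, fun _ h => h⟩
    · obtain ⟨x', hx'K, hsub, j, hj, hj'⟩ := exists_feasible_smaller_support A b hx hind
      have hlt : (univ.filter fun k => x' k ≠ 0).card < (univ.filter fun k => x k ≠ 0).card := by
        apply Finset.card_lt_card
        refine ⟨fun k hk => mem_filter.2 ⟨mem_univ k, fun h => (mem_filter.1 hk).2 (hsub k h)⟩, ?_⟩
        intro hsub'
        have : j ∈ univ.filter fun k => x' k ≠ 0 := hsub' (mem_filter.2 ⟨mem_univ j, hj⟩)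
        exact (mem_filter.1 this).2 hj'
      obtain ⟨x'', hx''K, hind'', hsub''⟩ := ih x' hx'K (by omega)
      exact ⟨x'', hx''K, hind'', fun k hk => hsub'' k (hsub k hk)⟩

/-- **Fundamental theorem of linear programming, part (ii)** (support form): if the linear program
`min cᵀx, Ax = b, x ≥ 0` has an optimal feasible solution, it has an optimal basic feasible
solution. [cite: LuenbergerYe2008, §2.4 Fundamental theorem of linear programming (ii)] -/
theorem exists_optimal_basic_feasible (A : Matrix m n ℝ) (b : m → ℝ) (c : n → ℝ) :
    ∀ (N : ℕ) (x : n → ℝ), x ∈ feasibleSet A b → (∀ z ∈ feasibleSet A b, c ⬝ᵥ x ≤ c ⬝ᵥ z) →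
      (univ.filter fun j => x j ≠ 0).card ≤ N →
      ∃ x' ∈ feasibleSet A b, SupportColsIndependent A x' ∧ c ⬝ᵥ x' = c ⬝ᵥ x ∧
        ∀ j, x j = 0 → x' j = 0 := by
  classical
  intro N
  induction N with
  | zero =>
    intro x hx _ hcard
    refine ⟨x, hx, fun w hw _ => ?_, rfl, fun _ h => h⟩
    have hall : ∀ j, x j = 0 := fun j => by
      by_contra hj
      have : j ∈ univ.filter fun k => x k ≠ 0 := mem_filter.2 ⟨mem_univ j, hj⟩
      rw [Finset.card_eq_zero.1 (Nat.le_zero.1 hcard)] at this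
      exact absurd this (Finset.notMem_empty j)
    exact funext fun j => hw j (hall j)
  | succ N ih =>
    intro x hx hopt hcard
    by_cases hind : SupportColsIndependent A x
    · exact ⟨x, hx, hind, rfl, fun _ h => h⟩
    · obtain ⟨x', hx'K, hcost, hsub, j, hj, hj'⟩ := exists_optimal_smaller_support A b c hx hopt hind
      have hlt : (univ.filter fun k => x' k ≠ 0).card < (univ.filter fun k => x k ≠ 0).card := by
        apply Finset.card_lt_card
        refine ⟨fun k hk => mem_filter.2 ⟨mem_univ k, fun h => (mem_filter.1 hk).2 (hsub k h)⟩, ?_⟩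
        intro hsub'
        have : j ∈ univ.filter fun k => x' k ≠ 0 := hsub' (mem_filter.2 ⟨mem_univ j, hj⟩)
        exact (mem_filter.1 this).2 hj'
      have hopt' : ∀ z ∈ feasibleSet A b, c ⬝ᵥ x' ≤ c ⬝ᵥ z := fun z hz => hcost ▸ hopt z hz
      obtain ⟨x'', hx''K, hind'', hcost'', hsub''⟩ := ih x' hx'K hopt' (by omega)
      exact ⟨x'', hx''K, hind'', hcost''.trans hcost, fun k hk => hsub'' k (hsub k hk)⟩

/-- **Corollary 1.** If `K` is nonempty, it has at least one extreme point.
[cite: LuenbergerYe2008, §2.5 Corollary 1] -/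
theorem extremePoints_nonempty (A : Matrix m n ℝ) (b : m → ℝ) (hK : (feasibleSet A b).Nonempty) :
    ((feasibleSet A b).extremePoints ℝ).Nonempty := by
  classical
  obtain ⟨x, hx⟩ := hK
  obtain ⟨x', hx'K, hind, -⟩ := exists_basic_feasible A b _ x hx le_rfl
  exact ⟨x', (mem_extremePoints_iff A b x').2 ⟨hx'K, hind⟩⟩

/-- **Corollary 2.** If a linear program (in standard form) has an optimal solution, it has an
optimal solution which is an extreme point of the constraint set.
[cite: LuenbergerYe2008, §2.5 Corollary 2] -/
theorem exists_optimal_mem_extremePoints (A : Matrix m n ℝ) (b : m → ℝ) (c : n → ℝ) {x : n → ℝ}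
    (hxK : x ∈ feasibleSet A b) (hopt : ∀ z ∈ feasibleSet A b, c ⬝ᵥ x ≤ c ⬝ᵥ z) :
    ∃ x' ∈ (feasibleSet A b).extremePoints ℝ, c ⬝ᵥ x' = c ⬝ᵥ x := by
  classical
  obtain ⟨x', hx'K, hind, hcost, -⟩ := exists_optimal_basic_feasible A b c _ x hxK hopt le_rfl
  exact ⟨x', (mem_extremePoints_iff A b x').2 ⟨hx'K, hind⟩, hcost⟩

end Literature.Analysis.Convex.ExtremePointsBasicSolutions
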